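import Summits.CriticalPhenomena.PercolationContinuityZ3.Theorems.PercNearOneGluingNoHeavyPcintMeanMemSound
import Summits.CriticalPhenomena.PercolationContinuityZ3.Theorems.PercNearOneGluingNoHeavyPcintThirdMemSym
import HarnessLib

/-!
# PCINT lane, reduction B3m on the memory-`τ` DANGEROUS-SET automaton — lattice symmetry and table certificates

Cell `prim-pcint` (PAPER-2 track (iii): certified intervals for `p_c(ℤ^d)`), seat `prim-pcint-2` (gen 4); support file
(`--supports stmt-CriticalPhenomena-4575`).  Does NOT build on p205010.  Memo: `run/shared/lean/prim/pcint/REDUCTIONS.md` §B3m.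

The symmetry/table layer of `…ThirdMemSym` for the B3m automaton `bmeanMemAut`: the corner-third sites are equivariant
(`cm3Set_smul`, `cmu_smul`), so `bmwt` and the totals are invariant under the hyperoctahedral group; the index automaton of a
table in simulation has the same totals, and a Collatz–Wielandt table certificate bounds them geometrically:
**`le_criticalProb_zd_of_meanMemTable`**.
-/

noncomputable section

namespace Summit.CriticalPhenomena.PercolationContinuityZ3.Theorems.Pcint

open Finset Literature.Probability.Percolation Literature.Probability.LatticeModels

/-! ### Lattice symmetries: equivariance of the B3m automaton -/

section SymB3m

variable {d : ℕ}

/-- **The corner-third sites are equivariant.** [folklore] -/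
theorem cm3Set_smul (kc : ℕ) (g : SPerm d) (S : MState d) (a : Fin d × Bool) :
    cm3Set kc (smulState g S) (smulLetter g a) = (cm3Set kc S a).image (smulSite g) := by
  classical
  have key : ∀ w : Site d, (∃ q ∈ smulState g S, q.2 = 1 ∧ q.1 (smulLetter g a).1 = 0 ∧
      smulSite g w = q.1 + stepVec (smulLetter g a)) ↔ (∃ q ∈ S, q.2 = 1 ∧ q.1 a.1 = 0 ∧ w = q.1 + stepVec a) := by
    intro w
    constructor
    · rintro ⟨q, hq, h1, hperp, hw⟩
      obtain ⟨r, hr, hqr⟩ := (mem_smulState g S q).1 hq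
      refine ⟨(r, q.2), hr, h1, (smulSite_apply_smulLetter_fst g r a).1 (by rw [← hqr]; exact hperp),
        smulSite_injective g ?_⟩
      rw [hw, hqr, stepVec_smulLetter, smulSite_add]
    · rintro ⟨q, hq, h1, hperp, hw⟩
      refine ⟨(smulSite g q.1, q.2), (mem_smulState g S _).2 ⟨q.1, by simpa using hq, rfl⟩, h1,
        (smulSite_apply_smulLetter_fst g q.1 a).2 hperp, ?_⟩
      rw [hw, smulSite_add, stepVec_smulLetter]
  ext w
  rw [cm3Set, cm3Set, mem_filter, cdetSet_smul, mem_image, mem_image]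
  constructor
  · rintro ⟨⟨w', hw', rfl⟩, hcond⟩
    exact ⟨w', mem_filter.2 ⟨hw', (key w').1 hcond⟩, rfl⟩
  · rintro ⟨w', hw', rfl⟩
    obtain ⟨hD, hcond⟩ := mem_filter.1 hw'
    exact ⟨⟨w', hD, rfl⟩, (key w').2 hcond⟩

/-- **The number of corner-third units is invariant.** [folklore] -/
theorem cmu_smul (kc : ℕ) (g : SPerm d) (S : MState d) (a : Fin d × Bool) :
    cmu kc (smulState g S) (smulLetter g a) = cmu kc S a := by
  unfold cmu; rw [cm3Set_smul, card_image_of_injective _ (smulSite_injective g)]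

/-- **The B3m step factor is invariant.** [folklore] -/
theorem bmwt_smul (q1 s tv mv κb : ℝ) (τ kc : ℕ) (g : SPerm d) (S : MState d) (a : Fin d × Bool) :
    bmwt q1 s tv mv κb τ kc (smulState g S) (smulLetter g a) = bmwt q1 s tv mv κb τ kc S a := by
  unfold bmwt; rw [bchord_smul, cdet_smul, ctu_smul, cmu_smul, bcorner_smul]

/-- Row sums of `bmeanMemAut` against an invariant function are invariant. [folklore] -/
theorem stepSum_bmeanMemAut_smul {τ kc : ℕ} {p q1 s tv mv κb : ℝ} (hp : 0 ≤ p) (hq : 0 ≤ q1) (hs : 0 ≤ s) (ht : 0 ≤ tv) (hm : 0 ≤ mv) (hκb : 0 ≤ κb)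
    (g : SPerm d) {f : MState d → ℝ} (hf : ∀ T, f (smulState g T) = f T) (S : MState d) :
    (bmeanMemAut τ kc p q1 s tv mv κb hp hq hs ht hm hκb).stepSum f (smulState g S) =
      (bmeanMemAut τ kc p q1 s tv mv κb hp hq hs ht hm hκb).stepSum f S := by
  unfold WAut.stepSum
  rw [← Equiv.sum_comp (letterEquiv g)]
  refine Finset.sum_congr rfl fun a _ => ?_
  have h1 : (bmeanMemAut τ kc p q1 s tv mv κb hp hq hs ht hm hκb).step (smulState g S) (letterEquiv g a) =
      ((bmeanMemAut τ kc p q1 s tv mv κb hp hq hs ht hm hκb).step S a).map (smulState g) := mstep_smul τ g S a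
  have h2 : (bmeanMemAut τ kc p q1 s tv mv κb hp hq hs ht hm hκb).wt (smulState g S) (letterEquiv g a) =
      (bmeanMemAut τ kc p q1 s tv mv κb hp hq hs ht hm hκb).wt S a := by
    show p * bmwt q1 s tv mv κb τ kc (smulState g S) (smulLetter g a) = p * bmwt q1 s tv mv κb τ kc S a
    rw [bmwt_smul]
  rw [h1, h2]
  cases (bmeanMemAut τ kc p q1 s tv mv κb hp hq hs ht hm hκb).step S a with
  | none => rfl
  | some T => simp only [Option.map_some, hf]

/-- **Totals of the B3m automaton are invariant under lattice symmetries.** [folklore] -/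
theorem total_bmeanMemAut_smul {τ kc : ℕ} {p q1 s tv mv κb : ℝ} (hp : 0 ≤ p) (hq : 0 ≤ q1) (hs : 0 ≤ s) (ht : 0 ≤ tv) (hm : 0 ≤ mv) (hκb : 0 ≤ κb)
    (g : SPerm d) : ∀ (n : ℕ) (S : MState d),
      (bmeanMemAut τ kc p q1 s tv mv κb hp hq hs ht hm hκb).total n (smulState g S) =
        (bmeanMemAut τ kc p q1 s tv mv κb hp hq hs ht hm hκb).total n S := by
  intro n
  induction n with
  | zero => intro S; rw [WAut.total_zero, WAut.total_zero]
  | succ n ih =>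
    intro S
    rw [WAut.total_succ, WAut.total_succ]
    exact stepSum_bmeanMemAut_smul hp hq hs ht hm hκb g (fun T => ih T) S

end SymB3m

/-! ### Table certificates modulo symmetry: a finite index automaton simulating `bmeanMemAut` -/

section Table

variable {d N : ℕ}

/-- The INDEX AUTOMATON of a bond table: states are row indices, transitions are read off the table, weights are
recomputed from the row's state. [folklore] -/
def bmtableAut (τ kc : ℕ) (p q1 s tv mv κb : ℝ) (hp : 0 ≤ p) (hq : 0 ≤ q1) (hs : 0 ≤ s) (ht : 0 ≤ tv) (hm : 0 ≤ mv)
    (hκb : 0 ≤ κb)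
    (R : Fin N → MState d) (sc : Fin N → Fin d × Bool → Option (Fin N × SPerm d)) : WAut (Fin N) (Fin d × Bool) where
  step i a := (sc i a).map Prod.fst
  wt i a := (bmeanMemAut τ kc p q1 s tv mv κb hp hq hs ht hm hκb).wt (R i) a
  wt_nonneg i a := (bmeanMemAut τ kc p q1 s tv mv κb hp hq hs ht hm hκb).wt_nonneg (R i) a

/-- **Simulation**: the index automaton of a table in simulation with `bmeanMemAut` has the same totals. [folklore] -/
theorem total_bmtableAut_eq {τ kc : ℕ} {p q1 s tv mv κb : ℝ} (hp : 0 ≤ p) (hq : 0 ≤ q1) (hs : 0 ≤ s) (ht : 0 ≤ tv) (hm : 0 ≤ mv) (hκb : 0 ≤ κb)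
    (R : Fin N → MState d) (sc : Fin N → Fin d × Bool → Option (Fin N × SPerm d))
    (hsim : ∀ i a, simRel R (mstep τ (R i) a) (sc i a) = true) :
    ∀ (n : ℕ) (i : Fin N), (bmtableAut τ kc p q1 s tv mv κb hp hq hs ht hm hκb R sc).total n i =
      (bmeanMemAut τ kc p q1 s tv mv κb hp hq hs ht hm hκb).total n (R i) := by
  intro n
  induction n with
  | zero => intro i; rw [WAut.total_zero, WAut.total_zero]
  | succ n ih =>
    intro i
    rw [WAut.total_succ, WAut.total_succ]
    unfold WAut.stepSum
    refine Finset.sum_congr rfl fun a _ => ?_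
    have h := hsim i a
    have e1 : (bmtableAut τ kc p q1 s tv mv κb hp hq hs ht hm hκb R sc).step i a = (sc i a).map Prod.fst := rfl
    have e2 : (bmeanMemAut τ kc p q1 s tv mv κb hp hq hs ht hm hκb).step (R i) a = mstep τ (R i) a := rfl
    rw [e1, e2]
    revert h
    generalize mstep τ (R i) a = oT
    generalize sc i a = oJ
    intro h
    cases oT with
    | none =>
      cases oJ with
      | none => rfl
      | some jg => exact absurd h (by simp [simRel])
    | some T =>
      cases oJ with
      | none => exact absurd h (by simp [simRel])
      | some jg =>
        have hT : T = smulState jg.2 (R jg.1) := by simpa [simRel] using h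
        simp only [Option.map_some]
        rw [ih jg.1, hT, total_bmeanMemAut_smul]
        rfl

/-- **Table certificate ⇒ geometric bound on the totals of `bmeanMemAut`.**  If the rows carry states `R i`, positive
weights `V i ≥ 1`, successor data in simulation with `mstep`, and satisfy the Collatz–Wielandt inequalities
`Σ_a p·btwt(R i,a)·V(succ) ≤ λ V i`, then `total n (R i) ≤ λⁿ V i` for every row. [folklore] -/
theorem total_bmeanMemAut_le_of_table {τ kc : ℕ} {p q1 s tv mv κb lam : ℝ} (hp : 0 ≤ p) (hq : 0 ≤ q1) (hs : 0 ≤ s) (ht : 0 ≤ tv)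
    (hm : 0 ≤ mv) (hκb : 0 ≤ κb) (hlam : 0 ≤ lam) (R : Fin N → MState d) (sc : Fin N → Fin d × Bool → Option (Fin N × SPerm d))
    (V : Fin N → ℝ) (hV : ∀ i, 1 ≤ V i) (hsim : ∀ i a, simRel R (mstep τ (R i) a) (sc i a) = true)
    (hcw : ∀ i, (∑ a : Fin d × Bool, match sc i a with
      | none => 0
      | some jg => p * bmwt q1 s tv mv κb τ kc (R i) a * V jg.1) ≤ lam * V i) (n : ℕ) (i : Fin N) :
    (bmeanMemAut τ kc p q1 s tv mv κb hp hq hs ht hm hκb).total n (R i) ≤ lam ^ n * V i := by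
  rw [← total_bmtableAut_eq hp hq hs ht hm hκb R sc hsim n i]
  have hcw' : ∀ i, (bmtableAut τ kc p q1 s tv mv κb hp hq hs ht hm hκb R sc).stepSum V i ≤ lam * V i := fun i => by
    refine le_of_eq_of_le ?_ (hcw i)
    unfold WAut.stepSum
    refine Finset.sum_congr rfl fun a _ => ?_
    have e1 : (bmtableAut τ kc p q1 s tv mv κb hp hq hs ht hm hκb R sc).step i a = (sc i a).map Prod.fst := rfl
    rw [e1]
    cases sc i a with
    | none => rfl
    | some jg => rfl
  have := (bmtableAut τ kc p q1 s tv mv κb hp hq hs ht hm hκb R sc).total_le_of_cw one_pos hV hlam hcw' n i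
  rwa [div_one] at this

/-- **Reduced-state B3m certificate (table form) ⇒ `p ≤ p_c^bond(ℤ^d)`.**  The row `i₀` with the empty state gives the bound
on the totals from `∅` needed by `le_criticalProb_zd_of_meanMem_total`. [folklore] -/
theorem le_criticalProb_zd_of_meanMemTable [NeZero d] {τ kc : ℕ} (hτ : kc + 4 ≤ τ) (hkc : 2 ≤ kc) (p : unitInterval)
    {s tv t' mv κb lam : ℝ} (hps : 1 - (p : ℝ) ^ 2 ≤ s ^ 2) (hs0 : 0 < s) (hs1 : s ≤ 1) (ht0 : 0 < tv) (htt : tv ≤ t')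
    (hts : t' ≤ s) (hmv : (tv + t') / 2 ≤ mv) (hms : mv ≤ s) (htp : (1 - (p : ℝ)) * (1 + 2 * p) ≤ tv * (1 + p))
    (hgap : (p : ℝ) ^ 2 ≤ (t' - tv) * (1 + p)) (hqt : 1 - (p : ℝ) ≤ s * tv ^ 2) (hts2 : tv ≤ s ^ 2)
    (hκb : (1 + s ^ 2) / 2 ≤ κb) (hlam0 : 0 ≤ lam) (hlam1 : lam < 1)
    (R : Fin N → MState d) (sc : Fin N → Fin d × Bool → Option (Fin N × SPerm d)) (V : Fin N → ℝ)
    (i₀ : Fin N) (h0 : R i₀ = ∅) (hV : ∀ i, 1 ≤ V i) (hsim : ∀ i a, simRel R (mstep τ (R i) a) (sc i a) = true)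
    (hcw : ∀ i, (∑ a : Fin d × Bool, match sc i a with
      | none => 0
      | some jg => (p : ℝ) * bmwt (1 - p) s tv mv κb τ kc (R i) a * V jg.1) ≤ lam * V i) :
    (p : ℝ) ≤ criticalProb (zdGraph d) 0 := by
  have hm0 : 0 ≤ mv := ht0.le.trans ((show tv ≤ (tv + t') / 2 by linarith).trans hmv)
  refine le_criticalProb_zd_of_meanMem_total hτ hkc p hps hs0 hs1 ht0 htt hts hmv hms htp hgap hqt hts2 hκb hlam0 hlam1 hm0
    (C := V i₀) fun n => ?_
  have h := total_bmeanMemAut_le_of_table p.2.1 (sub_nonneg.2 p.2.2) hs0.le ht0.le hm0 (by nlinarith)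
    hlam0 R sc V hV hsim hcw n i₀
  rw [h0] at h
  exact h.trans_eq (mul_comm _ _)

end Table

end Summit.CriticalPhenomena.PercolationContinuityZ3.Theorems.Pcint
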